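import Summits.Ventures.GridStability.Models.DroopQVTauAffine
import Summits.Ventures.GridStability.Models.WSCC9DroopQVLossyTauRayCert

/-!
# GridStability/Models/WSCC9DroopQVLossyTauRay — the ZERO-VIRTUAL-INERTIA ray: for EVERY filter time constant `0 < τ ≤ 1/2` the linearisation of the lossy construction «DROOPQV-WSCC9-LOSSY» at its (τ-independent) rest point is the rotation mode or has `Re z < −1`

Cell `gridfusion` (LADDER-GRIDFUSION, APEX LINE rung G3.b; seat gridfusion-model-8 (g4); default-work item (C) after lead g8 RULING 9ax (1), offered as
«G3.b-ss-DROOPQV-WSCC9L-ZERO-INERTIA-RAY»). Instance of `Models/DroopQVTauAffine.lean` (generic: `withTau`, `jacMatrix_withTau`) on #81's LOSSY object `WSCC9.droopQVL`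
with the data file `Models/WSCC9DroopQVLossyTauRayCert.lean`.
STATEMENT (`droopQVL_tau_eig_re_lt`): for every real `τ` with `0 < τ ≤ 1/2`, every complex eigenpair `(z, v)` of the `9 × 9` Jacobian `jacMatrix (θ*, V*)` of
`droopQVLτ τ := droopQVL.toMicrogrid.withTau τ` (the #81 construction — conductances and constant-impedance loads KEPT — with both low-pass filter constants
`τ_P = τ_Q = τ`; gains `k_P = 243/100`, `k_Q = 1/5` as printed; rest point unchanged, `droopQVL_tau_field_eq_zero`) is the rotation mode (`z = 0`, `v ∈ ℂ·r`) or
has `Re z < −1`; the rotation zero is algebraically simple (`droopQVL_tau_no_jordan_chain_at_zero`). In the equivalent swing model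
(`DroopMicrogrid.toClassicalSwing`: `M = τ/k_P`, `D = 1/k_P`) this is EVERY virtual inertia `0 < M ≤ 50/243` at fixed damping — the whole low-inertia limit
`M → 0` of the construction, at the rate `1`.
CERTIFICATE (solver-free in the kernel): in `σ = 1/τ ≥ 2` the deflated Jacobian is AFFINE, `J′(σ) = C′ + σ·D` (`DroopMicrogrid.jacDefl_withTau`: the angle rows
`θ̇ = ω` and the deflation do not read `τ`, the frequency/voltage rows scale with `1/τ`); AFFINE Lyapunov family `S(σ) = S₀ + σ·S₁` with `S₁` supported on the
ANGLE block ⇒ `S₁·D = 0` (`tau9S1Q_mul_DQ`) ⇒ `H(σ) = H(0) + σ·H₁` (`lyapCert_affine`); `S(2) ≻ 0`, `H(2) ≻ 0`, `H₁ ≻ 0` and `S₁ + (1 − P) ≻ 0` (four integer Gram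
certificates; `S₁ = P(S₁ + (1 − P))P` gives `S₁ ⪰ 0` by congruence, `Matrix.PosSemidef.conjTranspose_mul_mul_same`) ⇒ `S(σ) ≻ 0`, `H(σ) ≻ 0` for EVERY `σ ≥ 2`
(`posDef_affine_of_posSemidef_slope`) ⇒ `eig_re_lt_neg_of_deflate_withTau` (`ζ = zetaL`, `γ = −3`). Unlike the gain ray (`Models/WSCC9DroopQVGainRay.lean`,
lossless only), the inertia ray needs no structure beyond the support of `S₁` and closes WITH conductances.
DATA: packet `HOME/models/gen-model-8/g4/TAURAY-WSCC9L-cert.json` (sha16 e679ed6a1ebca6c7). Informative floats (ours, VALIDATED only): spectral abscissa of the deflated `J′(1/τ)`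
for `τ ∈ {1/2, 2/5, 1/4, 1/10, …, 10⁻⁶}` ∈ `[-3.0000, -1.0422]` (binding at the printed `τ = 1/2`: `−1.042`; for small `τ` the slow non-rotation modes tend to the
first-order droop modes `≈ −5.17, −8.18` and the printed value `−3` is the deflated rotation eigenvalue `γ`); LMI margin `t* ≈ 6.9e-03`.
THREE COLUMNS. CERTIFIED (kernel): matrix statements about the MODEL `droopQVLτ τ`, every real `0 < τ ≤ 1/2`. MODELLED: MV-6N (KunduEtAl2019 (4a)–(4c) with Q–V
dynamics) — SYNTHETIC/CONSTRUCTION as #81 (h12 `G` AND `B` of record, constant-impedance loads; `k_P = 243/100`, `k_Q = 1/5` AS PRINTED [cite: KunduEtAl2019, §V];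
`τ` the PARAMETER; set-points DEFINED from `(θ*, V*)`). VALIDATED: the float LMI solve behind `S₀, S₁`, float spectra. A statement about the linearisation at
ONE rest point for a RAY of filter constants — never a region of attraction, never the printed WSCC system; no sentence of this file says a grid, a microgrid or
a converter is stable.
-/

noncomputable section

open Real Matrix Finset
open scoped ComplexOrder
open Literature.Computation.Certificates

namespace Summit.Ventures.GridStability.Models

namespace WSCC9

/-! ## §1 The one-parameter family in `τ` and its `τ`-independent rest point -/

/-- **The lossy construction with common filter constant `τ = τ_P = τ_Q`** (everything else as `droopQVL`). MODELLED: SYNTHETIC/CONSTRUCTION, lossy,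
`τ` a parameter. [folklore] -/
def droopQVLτ (τ : ℝ) : DroopMicrogrid 3 := droopQVL.toMicrogrid.withTau τ

/-- **The rest point does not move with `τ`.** [folklore] -/
theorem droopQVL_tau_field_eq_zero (τ : ℝ) : (droopQVLτ τ).field (droopQVL.angleOf, 0, droopQVL.Vstar) = 0 :=
  droopQVL.toMicrogrid.withTau_field_eq_zero τ droopQVL.isSteadyState

/-- The Jacobian named below IS the derivative of the field of `droopQVLτ τ` (generic kernel fact, every state). [folklore] -/
theorem droopQVL_tau_hasFDerivAt_field (τ : ℝ) (x : DroopMicrogrid.State 3) :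
    HasFDerivAt (droopQVLτ τ).field ((droopQVLτ τ).jacCLM x) x :=
  (droopQVLτ τ).hasFDerivAt_field x

/-! ## §2 Bridges: the deflated Jacobian of `droopQVLτ τ` is `C′ + (1/τ)·D`, reindexed -/

/-- The `τ`-free part with deflation IS `tau9CQ`, reindexed. [folklore] -/
theorem droopQVL_jacBase_defl_eq : DroopMicrogrid.jacBase 3 + Matrix.vecMulVec DroopMicrogrid.rot zetaL
    = (tau9CQ.map ((↑) : ℚ → ℝ)).submatrix e9 e9 := by
  rw [DroopQVData.jacBase_eq 2]
  ext a b
  have h := tau9CQ_spec a b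
  simp only [Matrix.add_apply, Matrix.vecMulVec_apply] at h
  simp only [DroopQVData.jacBaseQ, Matrix.add_apply, Matrix.vecMulVec_apply, Matrix.map_apply, Matrix.submatrix_apply, ← h]
  push_cast
  congr 1
  rcases a with i | i | i <;> rcases b with j | j | j <;> simp [DroopMicrogrid.rot, rotLQ, zetaL, zetaLQ]

/-- The slope of the instance IS `tau9DQ`, reindexed. [folklore] -/
theorem droopQVL_jacTauSlope_eq : droopQVL.toMicrogrid.jacTauSlope droopQVL.angleOf droopQVL.Vstar
    = (tau9DQ.map ((↑) : ℚ → ℝ)).submatrix e9 e9 := by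
  rw [droopQVL.jacTauSlope_eq droopQVL_circle]
  ext a b
  have h := tau9DQ_spec a b
  simp only [DroopQVData.jacTauSlopeQ, Matrix.map_apply, Matrix.submatrix_apply, ← h]

/-- The real affine pencil of deflated Jacobians `J′(σ) = C′ + σ·D` (flattened). [folklore] -/
def tau9J9 (σ : ℝ) : Matrix (Fin 9) (Fin 9) ℝ := tau9CQ.map ((↑) : ℚ → ℝ) + σ • tau9DQ.map ((↑) : ℚ → ℝ)

/-- **The deflated Jacobian of `droopQVLτ τ` at `(θ*, V*)` IS `J′(1/τ)`, reindexed.** [folklore] -/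
theorem droopQVLτ_jacDefl_eq (τ : ℝ) : (droopQVLτ τ).jacDefl droopQVL.angleOf droopQVL.Vstar zetaL = (tau9J9 (1 / τ)).submatrix e9 e9 := by
  rw [droopQVLτ, DroopMicrogrid.jacDefl_withTau, droopQVL_jacBase_defl_eq, droopQVL_jacTauSlope_eq, tau9J9, Matrix.submatrix_add,
    Matrix.submatrix_smul]
  rfl

/-! ## §3 The affine Lyapunov family over `ℝ`; both slopes are positive semidefinite -/

/-- `S(σ) = S₀ + σ·S₁` over `ℝ` (flattened). [folklore] -/
def tau9S9 (σ : ℝ) : Matrix (Fin 9) (Fin 9) ℝ := tau9S0Q.map ((↑) : ℚ → ℝ) + σ • tau9S1Q.map ((↑) : ℚ → ℝ)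

/-- `H(σ) = S(σ)(−J′(σ)) + (S(σ)(−J′(σ)))ᵀ − 2·S(σ)` over `ℝ` (rate `r₀ = 1`). [folklore] -/
def tau9H9 (σ : ℝ) : Matrix (Fin 9) (Fin 9) ℝ := tau9S9 σ * (-tau9J9 σ) + (tau9S9 σ * (-tau9J9 σ))ᵀ - (2 * (1 : ℝ)) • tau9S9 σ

/-- Cast plumbing for the slope `H₁`. [folklore] -/
theorem tau9H1Q_map : tau9H1Q.map ((↑) : ℚ → ℝ)
    = -(tau9S0Q.map ((↑) : ℚ → ℝ) * tau9DQ.map ((↑) : ℚ → ℝ) + tau9S1Q.map ((↑) : ℚ → ℝ) * tau9CQ.map ((↑) : ℚ → ℝ))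
      - (tau9S0Q.map ((↑) : ℚ → ℝ) * tau9DQ.map ((↑) : ℚ → ℝ) + tau9S1Q.map ((↑) : ℚ → ℝ) * tau9CQ.map ((↑) : ℚ → ℝ))ᵀ
      - (2 * (1 : ℝ)) • tau9S1Q.map ((↑) : ℚ → ℝ) := by
  ext i j
  simp only [tau9H1Q, Matrix.map_apply, Matrix.sub_apply, Matrix.neg_apply, Matrix.add_apply, Matrix.mul_apply, Matrix.transpose_apply,
    Matrix.smul_apply, smul_eq_mul]
  push_cast
  rfl

/-- **`H(σ)` is AFFINE**: `H(σ) = H(0) + σ·H₁`. [folklore] -/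
theorem tau9H9_affine (σ : ℝ) : tau9H9 σ = tau9H9 0 + σ • tau9H1Q.map ((↑) : ℚ → ℝ) := by
  have h0 : tau9S1Q.map ((↑) : ℚ → ℝ) * tau9DQ.map ((↑) : ℚ → ℝ) = 0 := by
    rw [← map_ratCast_mul, tau9S1Q_mul_DQ]; simp
  have h := lyapCert_affine (tau9S0Q.map ((↑) : ℚ → ℝ)) (tau9S1Q.map ((↑) : ℚ → ℝ)) (tau9CQ.map ((↑) : ℚ → ℝ)) (tau9DQ.map ((↑) : ℚ → ℝ))
    (2 * (1 : ℝ)) σ h0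
  have h' := lyapCert_affine (tau9S0Q.map ((↑) : ℚ → ℝ)) (tau9S1Q.map ((↑) : ℚ → ℝ)) (tau9CQ.map ((↑) : ℚ → ℝ)) (tau9DQ.map ((↑) : ℚ → ℝ))
    (2 * (1 : ℝ)) 0 h0
  rw [tau9H9, tau9S9, tau9J9, h, tau9H9, tau9S9, tau9J9, h', zero_smul, add_zero, tau9H1Q_map]

/-- **The slope `S₁` is positive semidefinite**: `S₁ = P(S₁ + (1 − P))P` with `S₁ + (1 − P) ≻ 0` (Gram certificate) and `P` real symmetric. CERTIFIED. [folklore] -/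
theorem tau9S1_posSemidef : (tau9S1Q.map ((↑) : ℚ → ℝ)).PosSemidef := by
  obtain ⟨hproj, hsym⟩ := tau9S1Q_proj
  have hP : (tau9PQ.map ((↑) : ℚ → ℝ))ᴴ = tau9PQ.map ((↑) : ℚ → ℝ) := by
    rw [Matrix.conjTranspose_eq_transpose_of_trivial, ← Matrix.transpose_map, hsym]
  have h := tauS1L_posDef.posSemidef.conjTranspose_mul_mul_same (tau9PQ.map ((↑) : ℚ → ℝ))
  rw [hP, ← map_ratCast_mul, ← map_ratCast_mul, tau9S1LQ, hproj] at h
  exact h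

/-! ## §4 The certificates on the whole ray `σ ≥ 2` (every `0 < τ ≤ 1/2`) -/

/-- `S(σ) ≻ 0` for every `σ ≥ 2`. CERTIFIED. [folklore] -/
theorem tau9S9_posDef {σ : ℝ} (hσ : (2 : ℝ) ≤ σ) : (tau9S9 σ).PosDef := by
  have ha : (tau9S0Q.map ((↑) : ℚ → ℝ) + (((2 : ℚ)) : ℝ) • tau9S1Q.map ((↑) : ℚ → ℝ)).PosDef := by
    rw [← map_ratCast_add_smul]; exact tauSA_posDef
  exact posDef_affine_of_posSemidef_slope ha tau9S1_posSemidef (by push_cast; linarith)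

/-- `H` at `σ = 2`, read through the real pencil. [folklore] -/
theorem tau9H9_two : tau9H9 (((2 : ℚ)) : ℝ) = tau9HAQ.map ((↑) : ℚ → ℝ) := by
  rw [tau9HAQ, tau9SAQ, tau9JAQ, map_ratCast_lyapCert, map_ratCast_add_smul, map_ratCast_add_smul, tau9H9, tau9S9, tau9J9]
  push_cast
  rfl

/-- `H(σ) ≻ 0` for every `σ ≥ 2`. CERTIFIED. [folklore] -/
theorem tau9H9_posDef {σ : ℝ} (hσ : (2 : ℝ) ≤ σ) : (tau9H9 σ).PosDef := by
  have ha : (tau9H9 (((2 : ℚ)) : ℝ)).PosDef := by rw [tau9H9_two]; exact tauHA_posDef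
  rw [tau9H9_affine] at ha ⊢
  exact posDef_affine_of_posSemidef_slope ha tauH1_posDef.posSemidef (by push_cast; linarith)

/-! ## §5 The statement on the zero-inertia ray -/

/-- **RATE CERTIFICATE ON THE ZERO-VIRTUAL-INERTIA RAY (lossy construction).** For EVERY common filter constant `τ` with `0 < τ ≤ 1/2` (virtual inertia
`τ/k_P ∈ (0, 50/243]`), every complex eigenpair `(z, v)` of the `9 × 9` Jacobian `jacMatrix (θ*, V*)` of `droopQVLτ τ` (= «DROOPQV-WSCC9-LOSSY» with
`τ_P = τ_Q = τ`) is the rotation mode (`z = 0`, `v ∈ ℂ·r`) or has `Re z < −1`. CERTIFIED (one affine Lyapunov family in `1/τ`, four integer Gram certificates,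
deflation `γ = −3`); MODELLED: MV-6N SYNTHETIC/CONSTRUCTION, lossy, `τ` the parameter; VALIDATED: float abscissa of `J′(1/τ)` ∈ `[-3.0000, -1.0422]` for
`τ ∈ [10⁻⁶, 1/2]`. A statement about the linearisation at ONE rest point for a RAY of filter constants — not a region of attraction; no stability sentence. [folklore] -/
theorem droopQVL_tau_eig_re_lt {τ : ℝ} (hτ0 : 0 < τ) (hτ : τ ≤ 1 / 2)
    {z : ℂ} {v : Fin 3 ⊕ (Fin 3 ⊕ Fin 3) → ℂ} (hv : v ≠ 0)
    (hJ : ((droopQVLτ τ).jacMatrix droopQVL.angleOf droopQVL.Vstar).map ((↑) : ℝ → ℂ) *ᵥ v = z • v) :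
    (z = 0 ∧ ∃ a : ℂ, v = fun i => a * (DroopMicrogrid.rot i : ℂ)) ∨ z.re < -1 := by
  have hσ : (2 : ℝ) ≤ 1 / τ := by
    rw [le_div_iff₀ hτ0]; linarith
  have hS : ((tau9S9 (1 / τ)).submatrix e9 e9).PosDef := (tau9S9_posDef hσ).submatrix e9.injective
  have hH : ((tau9S9 (1 / τ)).submatrix e9 e9 * (-(droopQVLτ τ).jacDefl droopQVL.angleOf droopQVL.Vstar zetaL)
      + ((tau9S9 (1 / τ)).submatrix e9 e9 * (-(droopQVLτ τ).jacDefl droopQVL.angleOf droopQVL.Vstar zetaL))ᵀ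
      - (2 * (1 : ℝ)) • (tau9S9 (1 / τ)).submatrix e9 e9).PosDef := by
    rw [droopQVLτ_jacDefl_eq, lyapCert_submatrix]
    exact (tau9H9_posDef hσ).submatrix e9.injective
  exact droopQVL.toMicrogrid.eig_re_lt_neg_of_deflate_withTau τ droopQVL.angleOf droopQVL.Vstar zetaL one_pos
    (by simpa using zetaL_gamma.trans (by norm_num : -((1041 : ℝ) / 1000) < -1)) hS hH hv hJ

/-- **SIMPLE rotation zero on the whole ray**: for every `0 < τ ≤ 1/2` no complex `w` solves `jacMatrix (θ*, V*) w = r` for `droopQVLτ τ`. CERTIFIED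
(same certificate family); MODELLED as above. No stability sentence. [folklore] -/
theorem droopQVL_tau_no_jordan_chain_at_zero {τ : ℝ} (hτ0 : 0 < τ) (hτ : τ ≤ 1 / 2) {w : Fin 3 ⊕ (Fin 3 ⊕ Fin 3) → ℂ}
    (hw : ((droopQVLτ τ).jacMatrix droopQVL.angleOf droopQVL.Vstar).map ((↑) : ℝ → ℂ) *ᵥ w
      = fun i => ((DroopMicrogrid.rot i : ℝ) : ℂ)) : False := by
  have hσ : (2 : ℝ) ≤ 1 / τ := by
    rw [le_div_iff₀ hτ0]; linarith
  have hS : ((tau9S9 (1 / τ)).submatrix e9 e9).PosDef := (tau9S9_posDef hσ).submatrix e9.injective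
  have hH : ((tau9S9 (1 / τ)).submatrix e9 e9 * (-(droopQVLτ τ).jacDefl droopQVL.angleOf droopQVL.Vstar zetaL)
      + ((tau9S9 (1 / τ)).submatrix e9 e9 * (-(droopQVLτ τ).jacDefl droopQVL.angleOf droopQVL.Vstar zetaL))ᵀ
      - (2 * (1 : ℝ)) • (tau9S9 (1 / τ)).submatrix e9 e9).PosDef := by
    rw [droopQVLτ_jacDefl_eq, lyapCert_submatrix]
    exact (tau9H9_posDef hσ).submatrix e9.injective
  exact droopQVL.toMicrogrid.no_jordan_chain_at_zero_of_deflate_withTau τ droopQVL.angleOf droopQVL.Vstar zetaL one_pos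
    (by simpa using zetaL_gamma.trans (by norm_num : -((1041 : ℝ) / 1000) < -1)) hS hH hw

end WSCC9

end Summit.Ventures.GridStability.Models

end
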